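import Mathlib.Analysis.Distribution.AEEqOfIntegralContDiff
import Mathlib.Analysis.Calculus.ParametricIntegral
import Mathlib.MeasureTheory.Integral.Bochner.ContinuousLinearMap
import Literature.Analysis.FunctionSpaces.ContDiffMapSupportedInComplete
import Literature.Analysis.Complex.SchwarzReflection
import Literature.Analysis.Complex.SeveralVariables
import Literature.MathematicalPhysics.QuantumLattice.SchwingerWightmanSymmetry
import Literature.MathematicalPhysics.QuantumLattice.SchwartzTensorDensityProofs
import HarnessLib

/-!
# Uniqueness of distributional boundary values on the forward tube (ray form): proofs

Topic `Literature/MathematicalPhysics/QuantumLattice` (trunk T-AQFT); discharges the named fact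
`Literature.MathematicalPhysics.QuantumLattice.eq_zero_of_distributionalBoundaryValue_zero` of `SchwingerWightmanSymmetry.lean`
(`eq_zero_of_distributionalBoundaryValue_zero_holds`) and hence reduces
`IsWickRotationOf.schwinger_symmetric` to the two remaining named facts
(`IsWickRotationOf.schwinger_symmetric_of_continuation`: only the symmetric analytic
continuation `IsWightmanQFT.exists_symmetric_continuation` remains; the tensor density
`AQFT.denseSpan_tensorProducts` is discharged in the tree, `SchwartzTensorDensityProofs`).

**Theorem** (`eq_zero_of_rayBoundaryValue_zero`; Streater–Wightman (1964), Thm. 2-17 and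
Hörmander, *ALPDO I*, Thm. 3.1.15, in the ray form of `HasDistributionalBoundaryValue`). Let `G`
be holomorphic on the forward tube `𝒯ₙ` and suppose that for every direction `η` in the base
cone and every compactly supported test function `F`, `∫ G(x + i t η) F(x) dx → 0` as `t → 0⁺`.
Then `G = 0` on `𝒯ₙ`.

*Proof* (Hörmander's proof of Thm. 3.1.15 with the uniform boundedness principle supplying the
local bound that Hörmander assumes). Fix `z = x₀ + i y ∈ 𝒯ₙ`; then `y` lies in the base cone and
`z` is the point `λ = i` of the complex ray `x₀ + λ y` (`rayC`). For a smooth compactly supported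
`φ` put `Φ(λ) = ∫ G(x + λ y) φ(x) dx`.
1. `Φ` is holomorphic in `Im λ > 0` (differentiation under the integral sign, the derivative of
   `G` being bounded on compact families of rays by the continuity of `fderiv` of a holomorphic
   function of several variables, `Literature.Analysis.Complex.SCV.continuousOn_fderiv`):
   `differentiableAt_integral_rayC`.
2. `Φ(s + it) = Λ_t(φ(· − s y))` with the distributions `Λ_t = G(· + ity)` (translation
   invariance of Lebesgue measure; `integral_rayC_re_add_im`), realised as continuous linear
   functionals on the test function space `𝓓_K` for a compact `K` carrying all translates
   (`ContDiffMapSupportedIn.integralTestCLM`, `ContDiffMapSupportedIn.translateTest`, the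
   parameter clamped to `[-1, 1]` by Mathlib's `Set.projIcc`); `s ↦ φ(· − s y)` is continuous
   into `𝓓_K` (`ContDiffMapSupportedIn.continuous_translateTest`). The generic `𝓓_K` material
   lives in the namespace `Literature.ContDiffMapSupportedIn`, as in `ContDiffMapSupportedInComplete`.
3. By hypothesis `Λ_t ψ → 0` for every `ψ ∈ 𝓓_K`, and `t ↦ Λ_t ψ` is continuous, so the family
   `Λ_t`, `0 < t ≤ 2`, is pointwise bounded; `𝓓_K` is a Fréchet space
   (`Literature.Analysis.FunctionSpaces.ContDiffMapSupportedIn.instCompleteSpace`, hence barrelled), so by Banach–Steinhaus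
   `‖Λ_t ψ‖ ≤ C ‖ψ‖_{C^m}` uniformly (`ContDiffMapSupportedIn.exists_supSeminorm_bound`).
4. Hence `Φ` extended by `0` to `Im λ ≤ 0` is continuous on the strip `|Re λ| < 1` (at a real
   point `s₀`: `|Φ(s + it)| ≤ C ‖φ(· − sy) − φ(· − s₀y)‖_{C^m} + |Λ_t(φ(· − s₀ y))|`), holomorphic
   off the real axis, so holomorphic on the strip by Painlevé's theorem
   (`Complex.differentiableOn_of_continuousOn_of_differentiableAt_off_real`), and `≡ 0` by the
   identity theorem; in particular `Φ(i) = ∫ G(x + iy) φ(x) dx = 0`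
   (`integral_rayC_I_mul_eq_zero`).
5. As `φ` is arbitrary, `G(· + iy) = 0` a.e. (`ae_eq_zero_of_integral_contDiff_smul_eq_zero`),
   hence everywhere by continuity; at `x₀` this is `G z = 0`.

## References

* R. F. Streater, A. S. Wightman, *PCT, Spin and Statistics, and All That* (1964), Thm. 2-17
  (pdf p. 73 of the held 2000 printing). [StreaterWightman1964]
* L. Hörmander, *The Analysis of Linear Partial Differential Operators I* (1983), Thms. 3.1.14,
  3.1.15 (pdf pp. 57–58 of the held 2003 reprint). [HormanderALPDO1]
* W. Rudin, *Functional Analysis* (2nd ed. 1991), Thm. 2.6 (Banach–Steinhaus), §1.46, §6.5.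
  [Rudin1991]

## Mathlib / tree

Used: `hasDerivAt_integral_of_dominated_loc_of_deriv_le`, `WithSeminorms.banach_steinhaus`,
`WithSeminorms.uniformEquicontinuous_iff_bddAbove_and_continuous_iSup`,
`Seminorm.bound_of_continuous`, `ContDiffMapSupportedIn` (`𝓓_K`, its seminorms and structure
maps), `integral_add_right_eq_self`, `ae_eq_zero_of_integral_contDiff_smul_eq_zero`,
`AnalyticOnNhd.eqOn_zero_of_preconnected_of_eventuallyEq_zero`; from the tree:
`Complex.differentiableOn_of_continuousOn_of_differentiableAt_off_real` (Painlevé,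
`Literature/Analysis/Complex/SchwarzReflection`), `Literature.Analysis.Complex.SCV.continuousOn_fderiv`
(`Literature/Analysis/Complex/SeveralVariables`), `Literature.Analysis.FunctionSpaces.ContDiffMapSupportedIn.instCompleteSpace`
(`Literature/Analysis/FunctionSpaces/ContDiffMapSupportedInComplete`; barrelledness is then Mathlib's
`BaireSpace.instBarrelledSpace`), `complexifyPoint_add/smul`
(`WightmanProofs`).
-/

noncomputable section

open Filter Topology Complex MeasureTheory Set ContDiffMapSupportedIn
open scoped SchwartzMap Distributions BoundedContinuousFunction ContDiff NNReal Uniformity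

namespace Literature.MathematicalPhysics.QuantumLattice

variable {d n : ℕ}

/-! ### Complexified configurations and complex rays -/

/-- The real configuration `x ∈ (ℝ^{1+d})^n` as a complex one, `(cpxConfig x) k = x_k ∈ ℂ^{1+d}`.
[folklore] -/
def cpxConfig (x : Fin n → SpaceTime d) : Fin n → Fin (d + 1) → ℂ := fun k => complexifyPoint (x k)

/-- Components of `cpxConfig`. [folklore] -/
@[simp] theorem cpxConfig_apply (x : Fin n → SpaceTime d) (k : Fin n) :
    cpxConfig x k = complexifyPoint (x k) := rfl

/-- `cpxConfig` is additive. [folklore] -/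
theorem cpxConfig_add (x y : Fin n → SpaceTime d) :
    cpxConfig (x + y) = cpxConfig x + cpxConfig y := by
  funext k; simp [QuantumFieldTheory.complexifyPoint_add]

/-- `cpxConfig` commutes with real scalars. [folklore] -/
theorem cpxConfig_smul (t : ℝ) (x : Fin n → SpaceTime d) :
    cpxConfig (t • x) = (t : ℂ) • cpxConfig x := by
  funext k; simp [QuantumFieldTheory.complexifyPoint_smul]

/-- `cpxConfig` is continuous. [folklore] -/
theorem continuous_cpxConfig : Continuous (cpxConfig : (Fin n → SpaceTime d) → _) :=
  continuous_pi fun k => (continuous_pi fun μ =>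
    continuous_ofReal.comp ((EuclideanSpace.proj μ).continuous)).comp (continuous_apply k)

/-- The complex ray `x + λ η` through the real configuration `x` in the real direction `η`. For
`λ = i t` this is the ray of `HasDistributionalBoundaryValue`. [folklore] -/
def rayC (x η : Fin n → SpaceTime d) (l : ℂ) : Fin n → Fin (d + 1) → ℂ :=
  cpxConfig x + l • cpxConfig η

/-- Components of the complex ray. [folklore] -/
theorem rayC_apply (x η : Fin n → SpaceTime d) (l : ℂ) (k : Fin n) :
    rayC x η l k = complexifyPoint (x k) + l • complexifyPoint (η k) := rfl

/-- The ray of `HasDistributionalBoundaryValue` is `rayC x η (t i)`. [folklore] -/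
theorem rayC_mul_I (x η : Fin n → SpaceTime d) (t : ℝ) :
    rayC x η ((t : ℂ) * I) =
      fun k => complexifyPoint (x k) + ((t : ℂ) * I) • complexifyPoint (η k) :=
  rfl

/-- The imaginary part along the complex ray is `Im λ · η`. [folklore] -/
theorem imPart_rayC (x η : Fin n → SpaceTime d) (l : ℂ) (k : Fin n) :
    imPart (rayC x η l k) = l.im • η k := by
  ext μ; simp [rayC_apply]

/-- For `η` in the base cone and `Im λ > 0` the complex ray lies in the forward tube
(Streater–Wightman (1964), §3-3). [folklore] -/
theorem rayC_mem_forwardTube (x : Fin n → SpaceTime d) {η : Fin n → SpaceTime d}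
    (hη : η ∈ tubeCone d n) {l : ℂ} (hl : 0 < l.im) : rayC x η l ∈ forwardTube d n := by
  rw [mem_forwardTube_iff_imPart_mem_tubeCone]
  simp only [imPart_rayC]
  intro k
  rw [succDiff_map (fun v : SpaceTime d => l.im • v) (fun a b => smul_sub l.im a b)]
  exact smul_mem_forwardCone (hη k) hl

/-- Splitting the parameter into real and imaginary part moves the base point along `η`:
`x + (s + it) η = (x + s η) + i t η`. [folklore] -/
theorem rayC_eq_rayC_add (x η : Fin n → SpaceTime d) (l : ℂ) :
    rayC x η l = rayC (x + l.re • η) η ((l.im : ℂ) * I) := by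
  rw [rayC, rayC, cpxConfig_add, cpxConfig_smul]
  conv_lhs => rw [← re_add_im l]
  rw [add_smul, add_assoc]

/-- `x + (s + it) η = (x + s η) + i t η`. [folklore] -/
theorem rayC_re_add_im (x η : Fin n → SpaceTime d) (s t : ℝ) :
    rayC x η (s + t * I) = rayC (x + s • η) η ((t : ℂ) * I) := by
  rw [rayC_eq_rayC_add]; simp

/-- The complex ray is jointly continuous in the base point and the parameter. [folklore] -/
theorem continuous_rayC (η : Fin n → SpaceTime d) :
    Continuous fun p : (Fin n → SpaceTime d) × ℂ => rayC p.1 η p.2 := by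
  unfold rayC
  exact (continuous_cpxConfig.comp continuous_fst).add (continuous_snd.smul continuous_const)

/-- The complex ray is continuous in the base point. [folklore] -/
theorem continuous_rayC_left (η : Fin n → SpaceTime d) (l : ℂ) :
    Continuous fun x : Fin n → SpaceTime d => rayC x η l :=
  (continuous_rayC η).comp (continuous_id.prodMk continuous_const)

/-- The complex ray is affine in the parameter, with derivative the complexified direction.
[folklore] -/
theorem hasDerivAt_rayC (x η : Fin n → SpaceTime d) (l : ℂ) :
    HasDerivAt (rayC x η) (cpxConfig η) l := by
  unfold rayC
  simpa using ((hasDerivAt_id l).smul_const (cpxConfig η)).const_add (cpxConfig x)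

/-- A point of the forward tube is `rayC x y i` with `x = Re z`, `y = Im z ∈ tubeCone`.
[folklore] -/
theorem rayC_rePart_imPart (z : Fin n → Fin (d + 1) → ℂ) :
    rayC (fun k => rePart (z k)) (fun k => imPart (z k)) I = z := by
  funext k μ
  simp [rayC_apply, mul_comm I, re_add_im]

/-! ### Bounds on compact families of rays -/

/-- A continuous function on the forward tube is bounded on the rays `rayC x η λ`, `x ∈ S`,
`λ ∈ T`, for compact `S` and compact `T` in the open upper half-plane. [folklore] -/
theorem exists_bound_rayC {E : Type*} [SeminormedAddCommGroup E] {f : (Fin n → Fin (d + 1) → ℂ) → E}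
    (hf : ContinuousOn f (forwardTube d n)) {η : Fin n → SpaceTime d} (hη : η ∈ tubeCone d n)
    {S : Set (Fin n → SpaceTime d)} (hS : IsCompact S) {T : Set ℂ} (hT : IsCompact T)
    (hT' : T ⊆ {l | 0 < l.im}) : ∃ M, ∀ x ∈ S, ∀ l ∈ T, ‖f (rayC x η l)‖ ≤ M := by
  have hc : IsCompact ((fun p : (Fin n → SpaceTime d) × ℂ => rayC p.1 η p.2) '' S ×ˢ T) :=
    (hS.prod hT).image (continuous_rayC η)
  have hsub :
      (fun p : (Fin n → SpaceTime d) × ℂ => rayC p.1 η p.2) '' S ×ˢ T ⊆ forwardTube d n := by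
    rintro _ ⟨p, hp, rfl⟩
    exact rayC_mem_forwardTube p.1 hη (hT' hp.2)
  obtain ⟨M, hM⟩ := hc.exists_bound_of_continuousOn (hf.mono hsub)
  exact ⟨M, fun x hx l hl => hM _ ⟨(x, l), ⟨hx, hl⟩, rfl⟩⟩

/-! ### Test functions: integration functionals and translates -/

namespace ContDiffMapSupportedIn

section TestFunctions

variable {X : Type*} [NormedAddCommGroup X] [MeasurableSpace X] [BorelSpace X]

/-- Integration of bounded continuous functions against a continuous weight over a compact set,
`f ↦ ∫_K g f dμ`, as a continuous linear functional on `X →ᵇ ℂ`. [folklore] -/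
def integralBCF (g : X → ℂ) (hg : Continuous g) (K : TopologicalSpace.Compacts X) (μ : Measure X)
    [IsFiniteMeasureOnCompacts μ] : (X →ᵇ ℂ) →L[ℝ] ℂ :=
  LinearMap.mkContinuous
    { toFun := fun f => ∫ x in (K : Set X), g x * f x ∂μ
      map_add' := fun f f' => by
        simp only [BoundedContinuousFunction.coe_add, Pi.add_apply, mul_add]
        exact integral_add
          ((hg.mul f.continuous).continuousOn.integrableOn_compact K.isCompact)
          ((hg.mul f'.continuous).continuousOn.integrableOn_compact K.isCompact)
      map_smul' := fun c f => by
        simp only [BoundedContinuousFunction.coe_smul, RingHom.id_apply, real_smul]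
        rw [← integral_const_mul]
        congr 1
        funext x
        ring }
    (∫ x in (K : Set X), ‖g x‖ ∂μ) fun f => by
      simp only [LinearMap.coe_mk, AddHom.coe_mk]
      have hint : IntegrableOn (fun x => ‖g x‖) K μ :=
        hg.norm.continuousOn.integrableOn_compact K.isCompact
      calc ‖∫ x in (K : Set X), g x * f x ∂μ‖
          ≤ ∫ x in (K : Set X), ‖g x‖ * ‖f‖ ∂μ := by
            refine norm_integral_le_of_norm_le (hint.mul_const _) (Eventually.of_forall fun x => ?_)
            rw [norm_mul]
            exact mul_le_mul_of_nonneg_left (f.norm_coe_le_norm x) (norm_nonneg _)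
        _ = (∫ x in (K : Set X), ‖g x‖ ∂μ) * ‖f‖ := integral_mul_const _ _

/-- The defining formula of `integralBCF`. [folklore] -/
theorem integralBCF_apply (g : X → ℂ) (hg : Continuous g) (K : TopologicalSpace.Compacts X)
    (μ : Measure X) [IsFiniteMeasureOnCompacts μ] (f : X →ᵇ ℂ) :
    integralBCF g hg K μ f = ∫ x in (K : Set X), g x * f x ∂μ := rfl

/-- The functional `ψ ↦ ∫ g ψ dμ` on `𝓓_K` (a distribution given by the continuous function
`g`). [folklore] -/
def integralTestCLM [NormedSpace ℝ X] (g : X → ℂ) (hg : Continuous g)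
    (K : TopologicalSpace.Compacts X) (μ : Measure X) [IsFiniteMeasureOnCompacts μ] :
    𝓓_{K}(X, ℂ) →L[ℝ] ℂ :=
  (integralBCF g hg K μ).comp (toBoundedContinuousFunctionCLM ℝ)

/-- On `𝓓_K` the functional `integralTestCLM g` is `ψ ↦ ∫ g ψ` (the integrand vanishes off `K`).
[folklore] -/
theorem integralTestCLM_apply [NormedSpace ℝ X] (g : X → ℂ) (hg : Continuous g)
    (K : TopologicalSpace.Compacts X) (μ : Measure X) [IsFiniteMeasureOnCompacts μ]
    (ψ : 𝓓_{K}(X, ℂ)) :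
    integralTestCLM g hg K μ ψ = ∫ x, g x * ψ x ∂μ := by
  rw [integralTestCLM, ContinuousLinearMap.comp_apply, integralBCF_apply]
  refine setIntegral_eq_integral_of_forall_compl_eq_zero fun x hx => ?_
  simp [toBoundedContinuousFunctionCLM_apply, ψ.zero_on_compl hx]

end TestFunctions

section Translates

variable {X : Type*} [NormedAddCommGroup X] [NormedSpace ℝ X]

/-- `|projIcc (-1) 1 c| ≤ 1` (Mathlib's projection `Set.projIcc` onto `[-1, 1]`, used to clamp the
translation parameter). [folklore] -/
theorem abs_projIcc_le (c : ℝ) : |(Set.projIcc (-1 : ℝ) 1 (neg_le_self zero_le_one) c : ℝ)| ≤ 1 :=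
  abs_le.2 (Set.projIcc (-1 : ℝ) 1 (neg_le_self zero_le_one) c).2

/-- The translates `x ↦ φ (x - c η)`, `|c| ≤ 1` (the parameter clamped to `[-1, 1]` by Mathlib's
`Set.projIcc`), of a smooth function supported in the ball of radius `R`, as elements of `𝓓_K`
for `K` the closed ball of radius `R + ‖η‖`. [folklore] -/
def translateTest [ProperSpace X] {φ : X → ℂ} (hφ : ContDiff ℝ ∞ φ) {R : ℝ}
    (hR : tsupport φ ⊆ Metric.closedBall 0 R) (η : X) (c : ℝ) :
    𝓓_{⟨Metric.closedBall 0 (R + ‖η‖), isCompact_closedBall 0 _⟩}(X, ℂ) where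
  toFun x := φ (x - (Set.projIcc (-1 : ℝ) 1 (neg_le_self zero_le_one) c : ℝ) • η)
  contDiff' := hφ.comp ((contDiff_id.sub contDiff_const))
  zero_on_compl' x hx := by
    simp only [TopologicalSpace.Compacts.coe_mk, mem_compl_iff, Metric.mem_closedBall,
      dist_zero_right, not_le] at hx
    apply image_eq_zero_of_notMem_tsupport
    intro hmem
    have h1 : ‖x - (Set.projIcc (-1 : ℝ) 1 (neg_le_self zero_le_one) c : ℝ) • η‖ ≤ R := by
      simpa using hR hmem
    have h2 : ‖(Set.projIcc (-1 : ℝ) 1 (neg_le_self zero_le_one) c : ℝ) • η‖ ≤ ‖η‖ := by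
      rw [norm_smul, Real.norm_eq_abs]
      exact mul_le_of_le_one_left (norm_nonneg _) (abs_projIcc_le c)
    have h3 := norm_le_insert' x ((Set.projIcc (-1 : ℝ) 1 (neg_le_self zero_le_one) c : ℝ) • η)
    linarith

end Translates

section TranslatesCont

variable {X : Type*} [NormedAddCommGroup X] [NormedSpace ℝ X] [ProperSpace X]

/-- Values of the translates. [folklore] -/
theorem translateTest_apply {φ : X → ℂ} (hφ : ContDiff ℝ ∞ φ) {R : ℝ}
    (hR : tsupport φ ⊆ Metric.closedBall 0 R) (η : X) (c : ℝ) (x : X) :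
    translateTest hφ hR η c x = φ (x - (Set.projIcc (-1 : ℝ) 1 (neg_le_self zero_le_one) c : ℝ) • η) := rfl

/-- The structure maps of the translates are the translates of the derivatives. [folklore] -/
theorem structureMapCLM_translateTest {φ : X → ℂ} (hφ : ContDiff ℝ ∞ φ) {R : ℝ}
    (hR : tsupport φ ⊆ Metric.closedBall 0 R) (η : X) (c : ℝ) (i : ℕ) (x : X) :
    structureMapCLM ℝ ⊤ i (translateTest hφ hR η c) x =
      iteratedFDeriv ℝ i φ (x - (Set.projIcc (-1 : ℝ) 1 (neg_le_self zero_le_one) c : ℝ) • η) := by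
  rw [structureMapCLM_top_apply]
  change iteratedFDeriv ℝ i (fun x => φ (x - (Set.projIcc (-1 : ℝ) 1 (neg_le_self zero_le_one) c : ℝ) • η)) x = _
  rw [iteratedFDeriv_comp_sub]

/-- **Translation is continuous into `𝓓_K`**: `c ↦ φ(· − c η)` is continuous for the test
function topology (uniform continuity of each derivative of `φ`). [folklore] -/
theorem continuous_translateTest {φ : X → ℂ} (hφ : ContDiff ℝ ∞ φ) (hφc : HasCompactSupport φ)
    {R : ℝ} (hR : tsupport φ ⊆ Metric.closedBall 0 R) (η : X) :
    Continuous (translateTest hφ hR η) := by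
  rw [continuous_iff_comp]
  intro i
  have hunif : UniformContinuous (iteratedFDeriv ℝ i φ) :=
    (hφc.iteratedFDeriv i).uniformContinuous_of_continuous
      (hφ.continuous_iteratedFDeriv (mod_cast le_top))
  rw [Metric.continuous_iff]
  intro c₀ ε hε
  obtain ⟨δ, hδ, hδ'⟩ := Metric.uniformContinuous_iff.1 hunif (ε / 2) (half_pos hε)
  refine ⟨δ / (‖η‖ + 1), div_pos hδ (by positivity), fun c hc => ?_⟩
  rw [Function.comp_apply, Function.comp_apply]
  refine lt_of_le_of_lt ((BoundedContinuousFunction.dist_le (half_pos hε).le).2 fun x => ?_)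
    (half_lt_self hε)
  rw [structureMapCLM_translateTest, structureMapCLM_translateTest]
  refine (hδ' ?_).le
  rw [dist_eq_norm, sub_sub_sub_cancel_left, ← sub_smul, norm_smul, Real.norm_eq_abs]
  have hpos : 0 < ‖η‖ + 1 := by positivity
  have hc' : |c - c₀| < δ / (‖η‖ + 1) := by rwa [← Real.dist_eq]
  calc |(Set.projIcc (-1 : ℝ) 1 (neg_le_self zero_le_one) c₀ : ℝ) -
        (Set.projIcc (-1 : ℝ) 1 (neg_le_self zero_le_one) c : ℝ)| * ‖η‖
      ≤ |c₀ - c| * (‖η‖ + 1) := mul_le_mul (Set.abs_projIcc_sub_projIcc _) (by linarith)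
          (norm_nonneg _) (abs_nonneg _)
    _ < δ / (‖η‖ + 1) * (‖η‖ + 1) := mul_lt_mul_of_pos_right (by rwa [abs_sub_comm]) hpos
    _ = δ := div_mul_cancel₀ δ hpos.ne'

end TranslatesCont

end ContDiffMapSupportedIn

open QuantumLattice.ContDiffMapSupportedIn

/-! ### The boundary-value family and its translates -/

section Family

variable {d n : ℕ}

/-- `Φ(s + it) = Λ_t(φ(· − s η))`: moving the base point of the ray is a translation of the test
function (translation invariance of Lebesgue measure). [folklore] -/
theorem integral_rayC_re_add_im {G : (Fin n → Fin (d + 1) → ℂ) → ℂ} {η : Fin n → SpaceTime d}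
    {t : ℝ} (hc : Continuous fun x : Fin n → SpaceTime d => G (rayC x η ((t : ℂ) * I)))
    {φ : (Fin n → SpaceTime d) → ℂ} (hφ : ContDiff ℝ ∞ φ) {R : ℝ}
    (hR : tsupport φ ⊆ Metric.closedBall 0 R) {s : ℝ} (hs : |s| ≤ 1) :
    ∫ x, G (rayC x η (s + t * I)) * φ x =
      integralTestCLM (fun x => G (rayC x η ((t : ℂ) * I))) hc _ volume
        (ContDiffMapSupportedIn.translateTest hφ hR η s) := by
  rw [integralTestCLM_apply]
  simp only [ContDiffMapSupportedIn.translateTest_apply,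
    Set.projIcc_of_mem (neg_le_self zero_le_one) (Set.mem_Icc.2 (abs_le.1 hs))]
  have h := integral_add_right_eq_self (μ := (volume : Measure (Fin n → SpaceTime d)))
    (fun u : Fin n → SpaceTime d => G (rayC u η ((t : ℂ) * I)) * φ (u - s • η)) (s • η)
  simp only [add_sub_cancel_right] at h
  rw [← h]
  congr 1
  funext x
  rw [rayC_re_add_im]

end Family

/-! ### Holomorphy of the smeared ray function `λ ↦ ∫ G(x + λ η) φ(x) dx` -/

section Holomorphy

variable {d n : ℕ}

/-- **Differentiation under the integral sign**: for `G` holomorphic on the forward tube, `η` in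
the base cone and `φ` continuous of compact support, `λ ↦ ∫ G(x + λ η) φ(x) dx` is complex
differentiable on the upper half-plane (Hörmander, proof of Thm. 3.1.15: "an analytic function
of `w` when `0 < Im w`"). [folklore] -/
theorem differentiableAt_integral_rayC {G : (Fin n → Fin (d + 1) → ℂ) → ℂ}
    (hG : DifferentiableOn ℂ G (forwardTube d n)) {η : Fin n → SpaceTime d} (hη : η ∈ tubeCone d n)
    {φ : (Fin n → SpaceTime d) → ℂ} (hφ : Continuous φ) (hφc : HasCompactSupport φ) {l₀ : ℂ}
    (hl₀ : 0 < l₀.im) :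
    DifferentiableAt ℂ (fun l => ∫ x, G (rayC x η l) * φ x) l₀ := by
  -- a compact neighbourhood of `l₀` inside the upper half-plane
  set s : Set ℂ := Metric.closedBall l₀ (l₀.im / 2) with hs_def
  have hs_nhds : s ∈ 𝓝 l₀ := Metric.closedBall_mem_nhds l₀ (half_pos hl₀)
  have hs_im : s ⊆ {l | 0 < l.im} := by
    intro l hl
    have h1 : |l.im - l₀.im| ≤ l₀.im / 2 := by
      have := abs_im_le_norm (l - l₀)
      rw [sub_im] at this
      exact this.trans (mem_closedBall_iff_norm.1 hl)
    have h2 := (abs_le.1 h1).1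
    show 0 < l.im
    linarith
  have hopen : IsOpen {l : ℂ | 0 < l.im} := isOpen_lt continuous_const continuous_im
  -- continuity of `G` and of its derivative along rays
  have hGc : ∀ {l : ℂ}, 0 < l.im → Continuous fun x : Fin n → SpaceTime d => G (rayC x η l) :=
    fun hl => hG.continuousOn.comp_continuous (continuous_rayC_left η _)
      fun x => rayC_mem_forwardTube x hη hl
  have hG'c : ContinuousOn (fderiv ℂ G) (forwardTube d n) :=
    Literature.Analysis.Complex.SCV.continuousOn_fderiv hG isOpen_forwardTube
  -- the bound on the derivative over the compact family of rays
  obtain ⟨M, hM⟩ := exists_bound_rayC hG'c hη hφc.isCompact (isCompact_closedBall l₀ (l₀.im / 2))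
    hs_im
  set F' : ℂ → (Fin n → SpaceTime d) → ℂ := fun l x => fderiv ℂ G (rayC x η l) (cpxConfig η) * φ x
  have hres := hasDerivAt_integral_of_dominated_loc_of_deriv_le (μ := volume)
    (F := fun l x => G (rayC x η l) * φ x) (F' := F') (x₀ := l₀)
    (bound := fun x => M * ‖cpxConfig η‖ * ‖φ x‖) hs_nhds ?_ ?_ ?_ ?_ ?_ ?_
  · exact hres.2.differentiableAt
  · filter_upwards [hopen.mem_nhds hl₀] with l hl
    exact ((hGc hl).mul hφ).aestronglyMeasurable
  · exact ((hGc hl₀).mul hφ).integrable_of_hasCompactSupport hφc.mul_left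
  · refine Continuous.aestronglyMeasurable ?_
    refine Continuous.mul ?_ hφ
    have h1 : Continuous fun x : Fin n → SpaceTime d => fderiv ℂ G (rayC x η l₀) :=
      hG'c.comp_continuous (continuous_rayC_left η l₀) fun x => rayC_mem_forwardTube x hη hl₀
    exact h1.clm_apply continuous_const
  · refine Eventually.of_forall fun x l hl => ?_
    by_cases hx : x ∈ tsupport φ
    · calc ‖F' l x‖ ≤ ‖fderiv ℂ G (rayC x η l)‖ * ‖cpxConfig η‖ * ‖φ x‖ := by
            rw [norm_mul]
            exact mul_le_mul_of_nonneg_right (ContinuousLinearMap.le_opNorm _ _) (norm_nonneg _)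
        _ ≤ M * ‖cpxConfig η‖ * ‖φ x‖ := by
            gcongr
            exact hM x hx l hl
    · have h0 : φ x = 0 := image_eq_zero_of_notMem_tsupport hx
      simp [F', h0]
  · exact ((continuous_const.mul hφ.norm)).integrable_of_hasCompactSupport hφc.norm.mul_left
  · refine Eventually.of_forall fun x l hl => ?_
    have hmem : rayC x η l ∈ forwardTube d n := rayC_mem_forwardTube x hη (hs_im hl)
    have hGd : HasFDerivAt G (fderiv ℂ G (rayC x η l)) (rayC x η l) :=
      (hG.differentiableAt (isOpen_forwardTube.mem_nhds hmem)).hasFDerivAt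
    exact (hGd.comp_hasDerivAt l (hasDerivAt_rayC x η l)).mul_const (φ x)

/-- A function continuous on `(0, T₀]` with limit `0` at `0⁺` is bounded there. [folklore] -/
theorem exists_bound_of_continuousOn_of_tendsto {h : ℝ → ℂ} {T₀ : ℝ}
    (hc : ContinuousOn h (Ioc 0 T₀)) (h0 : Tendsto h (𝓝[>] 0) (𝓝 0)) :
    ∃ C, ∀ t ∈ Ioc 0 T₀, ‖h t‖ ≤ C := by
  have hev : ∀ᶠ t in 𝓝[>] (0 : ℝ), ‖h t‖ < 1 := by
    have := (Metric.tendsto_nhds.1 h0) 1 one_pos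
    simpa [dist_zero_right] using this
  rw [eventually_nhdsWithin_iff, Metric.eventually_nhds_iff] at hev
  obtain ⟨δ, hδ, hδ'⟩ := hev
  obtain ⟨B, hB⟩ := (isCompact_Icc (a := δ / 2) (b := T₀)).exists_bound_of_continuousOn
    (hc.mono fun t ht => ⟨(half_pos hδ).trans_le ht.1, ht.2⟩)
  refine ⟨max 1 B, fun t ht => ?_⟩
  by_cases htδ : t < δ
  · have : ‖h t‖ < 1 := hδ' (by simpa [abs_of_pos ht.1] using htδ) ht.1
    exact this.le.trans (le_max_left _ _)
  · exact (hB t ⟨by linarith, ht.2⟩).trans (le_max_right _ _)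

end Holomorphy


/-! ### The uniform boundedness principle in `𝓓_K` -/

namespace ContDiffMapSupportedIn

section BanachSteinhaus

variable {X : Type*} [NormedAddCommGroup X] [NormedSpace ℝ X] {K : TopologicalSpace.Compacts X}

/-- **Banach–Steinhaus in `𝓓_K`**: a family of distributions `Λ_t`, `t ∈ (0, T₀]`, given by
continuous linear functionals on `𝓓_K` and pointwise bounded, is bounded by a common multiple of
one of the norms `‖ψ‖_{C^m} = max_{i ≤ m} sup ‖Dⁱ ψ‖` (Rudin (1991), Thm. 2.6 with Thm. 6.8;
here through `WithSeminorms.banach_steinhaus` on the barrelled space `𝓓_K`,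
`Literature.Analysis.FunctionSpaces.ContDiffMapSupportedIn.instCompleteSpace` with Mathlib's `BaireSpace.instBarrelledSpace`). [cite: Rudin1991, Thm 2.6] -/
theorem exists_supSeminorm_bound (Λ : ℝ → 𝓓_{K}(X, ℂ) →L[ℝ] ℂ) (T₀ : ℝ)
    (hbdd : ∀ ψ : 𝓓_{K}(X, ℂ), ∃ C, ∀ t ∈ Ioc 0 T₀, ‖Λ t ψ‖ ≤ C) :
    ∃ (m : ℕ) (C : ℝ), 0 ≤ C ∧ ∀ t ∈ Ioc 0 T₀, ∀ ψ : 𝓓_{K}(X, ℂ),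
      ‖Λ t ψ‖ ≤ C * ContDiffMapSupportedIn.supSeminorm ℝ X ℂ ⊤ K m ψ := by
  let ι := {t : ℝ // t ∈ Ioc 0 T₀}
  let 𝓕 : ι → 𝓓_{K}(X, ℂ) →L[ℝ] ℂ := fun i => Λ i.1
  have H : ∀ (_ : Fin 1) (ψ : 𝓓_{K}(X, ℂ)),
      BddAbove (range fun i : ι => normSeminorm ℝ ℂ (𝓕 i ψ)) := by
    intro _ ψ
    obtain ⟨C, hC⟩ := hbdd ψ
    refine ⟨C, ?_⟩
    rintro _ ⟨i, rfl⟩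
    simpa [coe_normSeminorm] using hC i.1 i.2
  have hequi : UniformEquicontinuous ((↑) ∘ 𝓕) := (norm_withSeminorms ℝ ℂ).banach_steinhaus H
  obtain ⟨hbdd', hcont⟩ :=
    ((norm_withSeminorms ℝ ℂ).uniformEquicontinuous_iff_bddAbove_and_continuous_iSup
      (fun i => (𝓕 i).toLinearMap)).1 hequi 0
  set P : Seminorm ℝ 𝓓_{K}(X, ℂ) := ⨆ i, (normSeminorm ℝ ℂ).comp (𝓕 i).toLinearMap with hP_def
  have hcontP : Continuous P := by
    rw [hP_def, Seminorm.coe_iSup_eq hbdd']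
    exact hcont
  obtain ⟨s, C, -, hP⟩ :=
    Seminorm.bound_of_continuous (ContDiffMapSupportedIn.withSeminorms ℝ X ℂ ⊤ K) P hcontP
  refine ⟨s.sup id, C, C.coe_nonneg, fun t ht ψ => ?_⟩
  have h1 : ‖Λ t ψ‖ ≤ P ψ := by
    have hle : (normSeminorm ℝ ℂ).comp (𝓕 ⟨t, ht⟩).toLinearMap ≤ P := le_ciSup hbdd' ⟨t, ht⟩
    have := Seminorm.le_def.1 hle ψ
    simpa [Seminorm.comp_apply, coe_normSeminorm] using this
  have h2 : P ψ ≤ C * (s.sup (ContDiffMapSupportedIn.seminorm ℝ X ℂ ⊤ K)) ψ := by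
    have := Seminorm.le_def.1 hP ψ
    simpa [_root_.smul_apply, NNReal.smul_def] using this
  have h3 : (s.sup (ContDiffMapSupportedIn.seminorm ℝ X ℂ ⊤ K)) ψ ≤
      ContDiffMapSupportedIn.supSeminorm ℝ X ℂ ⊤ K (s.sup id) ψ := by
    refine Seminorm.le_def.1 (Finset.sup_mono fun i hi => ?_) ψ
    exact Finset.mem_Iic.2 (Finset.le_sup (f := id) hi)
  calc ‖Λ t ψ‖ ≤ P ψ := h1
    _ ≤ C * (s.sup (ContDiffMapSupportedIn.seminorm ℝ X ℂ ⊤ K)) ψ := h2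
    _ ≤ C * ContDiffMapSupportedIn.supSeminorm ℝ X ℂ ⊤ K (s.sup id) ψ :=
        mul_le_mul_of_nonneg_left h3 C.coe_nonneg

end BanachSteinhaus

end ContDiffMapSupportedIn

/-! ### Uniqueness of distributional boundary values -/

section Main

variable {d n : ℕ}

/-- The core of the uniqueness theorem: for `η` in the base cone and a smooth compactly supported
`φ`, if all ray boundary values of `G` in the direction `η` vanish then
`∫ G(x + i η) φ(x) dx = 0` (Hörmander, proof of Thm. 3.1.15: the function
`F(w) = ∫ φ(x) f(x + w y) dx` is analytic for `Im w > 0`, tends to `0` at the real axis, hence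
continues by `0` across it and vanishes identically). [cite: HormanderALPDO1, Thm 3.1.15] -/
theorem integral_rayC_I_mul_eq_zero {G : (Fin n → Fin (d + 1) → ℂ) → ℂ}
    (hG : DifferentiableOn ℂ G (forwardTube d n)) {η : Fin n → SpaceTime d} (hη : η ∈ tubeCone d n)
    (hlim : ∀ F : 𝓢((Fin n → SpaceTime d), ℂ), HasCompactSupport (F : (Fin n → SpaceTime d) → ℂ) →
      Tendsto (fun t : ℝ => ∫ x, G (rayC x η ((t : ℂ) * I)) * F x) (𝓝[>] 0) (𝓝 0))
    {φ : (Fin n → SpaceTime d) → ℂ} (hφ : ContDiff ℝ ∞ φ) (hφc : HasCompactSupport φ) :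
    ∫ x, G (rayC x η I) * φ x = 0 := by
  -- the compact set carrying all translates of `φ`
  obtain ⟨R, hR⟩ := hφc.isCompact.isBounded.subset_closedBall 0
  let K : TopologicalSpace.Compacts (Fin n → SpaceTime d) :=
    ⟨Metric.closedBall 0 (R + ‖η‖), isCompact_closedBall 0 _⟩
  -- continuity of `G` along the rays
  have hGc : ∀ {l : ℂ}, 0 < l.im → Continuous fun x : Fin n → SpaceTime d => G (rayC x η l) :=
    fun hl => hG.continuousOn.comp_continuous (continuous_rayC_left η _)
      fun x => rayC_mem_forwardTube x hη hl
  have hIt : ∀ {t : ℝ}, 0 < t → 0 < ((t : ℂ) * I).im := fun ht => by simpa using ht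
  -- the family of distributions `Λ_t = G(· + i t η)`, `t > 0`
  let Λ : ℝ → 𝓓_{K}((Fin n → SpaceTime d), ℂ) →L[ℝ] ℂ := fun t =>
    if ht : 0 < t then
      integralTestCLM (fun x => G (rayC x η ((t : ℂ) * I))) (hGc (hIt ht)) K volume
    else 0
  have hΛ : ∀ {t : ℝ}, 0 < t → ∀ ψ : 𝓓_{K}((Fin n → SpaceTime d), ℂ),
      Λ t ψ = ∫ x, G (rayC x η ((t : ℂ) * I)) * ψ x := by
    intro t ht ψ
    simp only [Λ, dif_pos ht]
    exact integralTestCLM_apply _ _ _ _ _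
  -- pointwise convergence to `0`
  have hΛlim : ∀ ψ : 𝓓_{K}((Fin n → SpaceTime d), ℂ),
      Tendsto (fun t => Λ t ψ) (𝓝[>] 0) (𝓝 0) := by
    intro ψ
    have h := hlim (ψ.compact_supp.toSchwartzMap ψ.contDiff) ψ.compact_supp
    refine h.congr' ?_
    filter_upwards [self_mem_nhdsWithin] with t ht
    exact (hΛ ht ψ).symm
  -- pointwise boundedness on `(0, 2]`
  have hbdd : ∀ ψ : 𝓓_{K}((Fin n → SpaceTime d), ℂ), ∃ C, ∀ t ∈ Ioc (0 : ℝ) 2, ‖Λ t ψ‖ ≤ C := by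
    intro ψ
    refine exists_bound_of_continuousOn_of_tendsto ?_ (hΛlim ψ)
    have hΦψ : ∀ t : ℝ, 0 < t →
        ContinuousAt (fun t : ℝ => ∫ x, G (rayC x η ((t : ℂ) * I)) * ψ x) t := by
      intro t ht
      have hd := differentiableAt_integral_rayC hG hη ψ.continuous ψ.compact_supp (hIt ht)
      exact hd.continuousAt.comp (f := fun t : ℝ => (t : ℂ) * I)
        (by fun_prop : Continuous fun t : ℝ => (t : ℂ) * I).continuousAt
    intro t ht
    refine ((hΦψ t ht.1).congr ?_).continuousWithinAt
    filter_upwards [(isOpen_lt continuous_const continuous_id).mem_nhds ht.1] with t' ht'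
    exact (hΛ ht' ψ).symm
  -- the uniform boundedness principle
  obtain ⟨m, C, hC0, hC⟩ := exists_supSeminorm_bound Λ 2 hbdd
  -- the translates of `φ`
  let τ : ℝ → 𝓓_{K}((Fin n → SpaceTime d), ℂ) := ContDiffMapSupportedIn.translateTest hφ hR η
  have hτc : Continuous τ := continuous_translateTest hφ hφc hR η
  -- the smeared ray function, its values through the family, its holomorphy
  let Φ : ℂ → ℂ := fun l => ∫ x, G (rayC x η l) * φ x
  have hΦΛ : ∀ {l : ℂ}, 0 < l.im → |l.re| ≤ 1 → Φ l = Λ l.im (τ l.re) := by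
    intro l hl hre
    rw [hΛ hl]
    have h := integral_rayC_re_add_im (G := G) (η := η) (hGc (hIt hl)) hφ hR hre (t := l.im)
    rw [integralTestCLM_apply] at h
    simp only [re_add_im] at h
    exact h
  have hΦd : ∀ {l : ℂ}, 0 < l.im → DifferentiableAt ℂ Φ l :=
    fun hl => differentiableAt_integral_rayC hG hη hφ.continuous hφc hl
  -- the glued function and the domain
  let g : ℂ → ℂ := fun l => if 0 < l.im then Φ l else 0
  let U : Set ℂ := (re ⁻¹' Ioo (-1 : ℝ) 1) ∩ (im ⁻¹' Iio 2)
  have hUo : IsOpen U :=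
    (isOpen_Ioo.preimage continuous_re).inter (isOpen_Iio.preimage continuous_im)
  have hUc : Convex ℝ U :=
    ((convex_Ioo (-1 : ℝ) 1).linear_preimage reLm).inter ((convex_Iio (2 : ℝ)).linear_preimage imLm)
  have hopen_pos : IsOpen {l : ℂ | 0 < l.im} := isOpen_lt continuous_const continuous_im
  have hopen_neg : IsOpen {l : ℂ | l.im < 0} := isOpen_lt continuous_im continuous_const
  have hg_pos : ∀ {l : ℂ}, 0 < l.im → g =ᶠ[𝓝 l] Φ := fun hl =>
    Filter.eventually_of_mem (hopen_pos.mem_nhds hl) fun l' hl' => if_pos hl'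
  have hg_neg : ∀ {l : ℂ}, l.im < 0 → g =ᶠ[𝓝 l] fun _ => 0 := fun hl =>
    Filter.eventually_of_mem (hopen_neg.mem_nhds hl) fun l' (hl' : l'.im < 0) =>
      if_neg (not_lt.2 hl'.le)
  -- continuity of the glued function on `U`
  have hgc : ContinuousOn g U := by
    intro l₀ hl₀
    rcases lt_trichotomy l₀.im 0 with hneg | hzero | hpos
    · exact (continuousAt_const.congr (hg_neg hneg).symm).continuousWithinAt
    · -- a real point of `U`
      set s₀ := l₀.re with hs₀
      have hs₀mem : s₀ ∈ Ioo (-1 : ℝ) 1 := hl₀.1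
      rw [Metric.continuousWithinAt_iff]
      intro ε hε
      -- (ii) the pointwise limit at the translate `τ s₀`
      have h2 : ∀ᶠ t in 𝓝[>] (0 : ℝ), ‖Λ t (τ s₀)‖ < ε / 2 := by
        have := (Metric.tendsto_nhds.1 (hΛlim (τ s₀))) (ε / 2) (half_pos hε)
        simpa [dist_zero_right] using this
      rw [eventually_nhdsWithin_iff, Metric.eventually_nhds_iff] at h2
      obtain ⟨δ₁, hδ₁, hδ₁'⟩ := h2
      -- (i) continuity of the translates in the `C^m` seminorm
      let q := ContDiffMapSupportedIn.supSeminorm ℝ (Fin n → SpaceTime d) ℂ ⊤ K m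
      have hq : Continuous q :=
        (ContDiffMapSupportedIn.withSeminorms' ℝ (Fin n → SpaceTime d) ℂ ⊤ K).continuous_seminorm m
      have h1 : Tendsto (fun s => C * q (τ s - τ s₀)) (𝓝 s₀) (𝓝 0) := by
        have hτ0 : Tendsto (fun s => τ s - τ s₀) (𝓝 s₀) (𝓝 0) := by
          have hc' : Continuous fun s => τ s - τ s₀ := hτc.sub continuous_const
          have h := hc'.tendsto s₀
          rwa [sub_self] at h
        have := ((hq.tendsto 0).comp hτ0).const_mul C
        simpa [map_zero] using this
      have h1' : ∀ᶠ s in 𝓝 s₀, C * q (τ s - τ s₀) < ε / 2 := by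
        have := (Metric.tendsto_nhds.1 h1) (ε / 2) (half_pos hε)
        filter_upwards [this] with s hs
        rwa [Real.dist_eq, sub_zero, abs_of_nonneg (mul_nonneg hC0 (apply_nonneg q _))] at hs
      rw [Metric.eventually_nhds_iff] at h1'
      obtain ⟨δ₂, hδ₂, hδ₂'⟩ := h1'
      obtain ⟨δ₃, hδ₃, hδ₃'⟩ := Metric.isOpen_iff.1 isOpen_Ioo s₀ hs₀mem
      refine ⟨min δ₁ (min δ₂ δ₃), lt_min hδ₁ (lt_min hδ₂ hδ₃), fun l hlU hdist => ?_⟩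
      have hg0 : g l₀ = 0 := if_neg (by rw [hzero]; exact lt_irrefl 0)
      rw [hg0]
      by_cases hl : 0 < l.im
      · rw [show g l = Φ l from if_pos hl, dist_zero_right]
        have hd1 : dist l l₀ < δ₁ := hdist.trans_le (min_le_left _ _)
        have hd2 : dist l l₀ < δ₂ := hdist.trans_le ((min_le_right _ _).trans (min_le_left _ _))
        have hd3 : dist l l₀ < δ₃ := hdist.trans_le ((min_le_right _ _).trans (min_le_right _ _))
        have hre_le : dist l.re s₀ ≤ dist l l₀ := by
          rw [Real.dist_eq, dist_eq_norm, hs₀, ← sub_re]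
          exact abs_re_le_norm (l - l₀)
        have him_le : dist l.im 0 ≤ dist l l₀ := by
          rw [Real.dist_eq, sub_zero, dist_eq_norm]
          have := abs_im_le_norm (l - l₀)
          rwa [sub_im, hzero, sub_zero] at this
        have hre_mem : l.re ∈ Ioo (-1 : ℝ) 1 := hδ₃' (hre_le.trans_lt hd3)
        have habs : |l.re| ≤ 1 := abs_le.2 ⟨hre_mem.1.le, hre_mem.2.le⟩
        rw [hΦΛ hl habs]
        have ht_mem : l.im ∈ Ioc (0 : ℝ) 2 := ⟨hl, le_of_lt hlU.2⟩
        have hterm1 : ‖Λ l.im (τ l.re - τ s₀)‖ < ε / 2 :=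
          (hC _ ht_mem _).trans_lt (hδ₂' (hre_le.trans_lt hd2))
        have hterm2 : ‖Λ l.im (τ s₀)‖ < ε / 2 := hδ₁' (him_le.trans_lt hd1) hl
        calc ‖Λ l.im (τ l.re)‖ = ‖Λ l.im (τ l.re - τ s₀) + Λ l.im (τ s₀)‖ := by
              rw [map_sub, sub_add_cancel]
          _ ≤ ‖Λ l.im (τ l.re - τ s₀)‖ + ‖Λ l.im (τ s₀)‖ := norm_add_le _ _
          _ < ε / 2 + ε / 2 := add_lt_add hterm1 hterm2
          _ = ε := add_halves ε
      · rw [show g l = 0 from if_neg hl, dist_self]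
        exact hε
    · exact ((hΦd hpos).continuousAt.congr (hg_pos hpos).symm).continuousWithinAt
  -- differentiability off the real axis, Painlevé, identity theorem
  have hgd : ∀ l ∈ U, l.im ≠ 0 → DifferentiableAt ℂ g l := by
    intro l _ hne
    rcases lt_or_gt_of_ne hne with hneg | hpos
    · exact (differentiableAt_const (0 : ℂ)).congr_of_eventuallyEq (hg_neg hneg)
    · exact (hΦd hpos).congr_of_eventuallyEq (hg_pos hpos)
  have hgU : DifferentiableOn ℂ g U :=
    Complex.differentiableOn_of_continuousOn_of_differentiableAt_off_real hUo hgc hgd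
  have hI : I ∈ U := ⟨by simp, by norm_num⟩
  have hnegI : -I ∈ U := ⟨by simp, by norm_num⟩
  have hzero : EqOn g 0 U :=
    (hgU.analyticOnNhd hUo).eqOn_zero_of_preconnected_of_eventuallyEq_zero hUc.isPreconnected
      hnegI (hg_neg (by norm_num))
  have h := hzero hI
  have hgI : g I = Φ I := if_pos (by norm_num)
  rw [hgI] at h
  exact h

/-- **Uniqueness of distributional boundary values, ray form** (discharges the named fact
`eq_zero_of_distributionalBoundaryValue_zero` of `SchwingerWightmanSymmetry`): a function
holomorphic on the forward tube all of whose ray boundary values on compactly supported test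
functions vanish is identically zero (Streater–Wightman (1964), Thm. 2-17; Hörmander (1983),
Thm. 3.1.15). Proof: through each point `z = x + iy` of the tube passes the ray family in the
direction `y ∈` base cone; for a test function `φ`, the smeared function
`Φ(λ) = ∫ G(x + λy) φ(x) dx` is holomorphic in `Im λ > 0` (differentiation under the integral),
its values are those of the distributions `Λ_t = G(· + ity)` on translates of `φ`, the family
`Λ_t`, `0 < t ≤ 2`, is pointwise bounded on the Fréchet space `𝓓_K`
(`Literature.Analysis.FunctionSpaces.ContDiffMapSupportedIn.instCompleteSpace`) hence uniformly bounded in a `C^m` norm (Banach–Steinhaus),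
which makes the extension of `Φ` by `0` continuous across the real axis; by Painlevé's theorem
(`Complex.differentiableOn_of_continuousOn_of_differentiableAt_off_real`) and the identity theorem
`Φ ≡ 0`, so `∫ G(x + iy) φ(x) dx = 0` for all `φ`, and `G(· + iy) = 0` by continuity.
[cite: StreaterWightman1964, Thm 2-17] -/
theorem eq_zero_of_rayBoundaryValue_zero {G : (Fin n → Fin (d + 1) → ℂ) → ℂ}
    (hG : DifferentiableOn ℂ G (forwardTube d n))
    (hlim : ∀ η ∈ tubeCone d n, ∀ F : 𝓢((Fin n → SpaceTime d), ℂ),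
      HasCompactSupport (F : (Fin n → SpaceTime d) → ℂ) →
      Tendsto (fun t : ℝ => ∫ x : Fin n → SpaceTime d,
        G (fun k => complexifyPoint (x k) + ((t : ℂ) * I) • complexifyPoint (η k)) * F x)
        (𝓝[>] 0) (𝓝 0))
    {z : Fin n → Fin (d + 1) → ℂ} (hz : z ∈ forwardTube d n) : G z = 0 := by
  have hy : (fun k => imPart (z k)) ∈ tubeCone d n :=
    (mem_forwardTube_iff_imPart_mem_tubeCone z).1 hz
  set η := fun k => imPart (z k) with hη_def
  have key : ∀ x : Fin n → SpaceTime d, G (rayC x η I) = 0 := by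
    have hlimη : ∀ F : 𝓢((Fin n → SpaceTime d), ℂ),
        HasCompactSupport (F : (Fin n → SpaceTime d) → ℂ) →
        Tendsto (fun t : ℝ => ∫ x, G (rayC x η ((t : ℂ) * I)) * F x) (𝓝[>] 0) (𝓝 0) :=
      fun F hF => hlim η hy F hF
    have hD : ∀ φ : (Fin n → SpaceTime d) → ℂ, ContDiff ℝ ∞ φ → HasCompactSupport φ →
        ∫ x, G (rayC x η I) * φ x = 0 :=
      fun φ hφ hφc => integral_rayC_I_mul_eq_zero hG hy hlimη hφ hφc
    have hcont : Continuous fun x : Fin n → SpaceTime d => G (rayC x η I) :=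
      hG.continuousOn.comp_continuous (continuous_rayC_left η I)
        fun x => rayC_mem_forwardTube x hy (by norm_num)
    have hae : ∀ᵐ x ∂(volume : Measure (Fin n → SpaceTime d)), G (rayC x η I) = 0 := by
      refine ae_eq_zero_of_integral_contDiff_smul_eq_zero hcont.locallyIntegrable
        fun g hg hgc => ?_
      have h := hD (fun x => (g x : ℂ)) (ofRealCLM.contDiff.comp hg) (hgc.comp_left ofReal_zero)
      rw [← h]
      congr 1
      funext x
      rw [real_smul, mul_comm]
    have heq := (hcont.ae_eq_iff_eq volume continuous_const).1 hae
    exact fun x => congrFun heq x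
  have h := key fun k => rePart (z k)
  rwa [hη_def, rayC_rePart_imPart] at h

end Main

/-! ### Discharge of the named fact and the two-hypothesis assembly -/

section Discharge

variable {d : ℕ}

/-- **Discharge** of the named fact `eq_zero_of_distributionalBoundaryValue_zero` of
`SchwingerWightmanSymmetry` (Streater–Wightman (1964), Thm. 2-17, ray form), by
`eq_zero_of_rayBoundaryValue_zero`. [cite: StreaterWightman1964, Thm 2-17] -/
theorem eq_zero_of_distributionalBoundaryValue_zero_holds :
    eq_zero_of_distributionalBoundaryValue_zero (d := d) :=
  fun _ hG hlim _ hz => eq_zero_of_rayBoundaryValue_zero hG hlim hz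

variable {κ : Type*}

/-- **Assembly with the boundary-value and density facts discharged**: the symmetric analytic
continuation of the Wightman functions to the permuted extended tube
(`IsWightmanQFT.exists_symmetric_continuation`, Streater–Wightman Thms. 3-5, 3-6 with the
Bargmann–Hall–Wightman theorem) alone implies `IsWickRotationOf.schwinger_symmetric`; the
uniqueness of boundary values is `eq_zero_of_distributionalBoundaryValue_zero_holds` (this file)
and the totality of tensor products is `AQFT.denseSpan_tensorProducts_holds`
(`SchwartzTensorDensityProofs`). [folklore] -/
theorem IsWickRotationOf.schwinger_symmetric_of_continuation
    (hC : IsWightmanQFT.exists_symmetric_continuation (d := d) (κ := κ)) :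
    IsWickRotationOf.schwinger_symmetric (d := d) (κ := κ) :=
  IsWickRotationOf.schwinger_symmetric_of eq_zero_of_distributionalBoundaryValue_zero_holds hC
    QuantumLattice.denseSpan_tensorProducts_holds

end Discharge

end Literature.MathematicalPhysics.QuantumLattice
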